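import Mathlib
import Summits.ABC.ABC.Theorems.ThreeSlotShapes
import Literature.NumberTheory.Congruences.ZsigmondyTheoremGeneral

/-!
# `ZooSorting`, three prime powers with a shared exponent factor (birth stub `stub_threePP_rest`)

Support for `ZooSorting` (stmt-ABC-24024) on `route-ABC-ThreeSlotCyclotomicDescent`: abc triples
`p^x + q^y = r^z` (three prime powers, `a, b ≥ 2`, `ω(abc) ≤ 3`) whose exponents are NOT pairwise
coprime and in which the exponent of `c` does not share the factor `2` with that of `a` or `b`, are
sorted ε-free:

* `x, y` share an odd prime `ℓ`: `A^ℓ + B^ℓ = r^z` is EMPTY (`no_sum_shape`: `A + B = r^s` divides it,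
  against the primitive prime divisor of Bang–Zsigmondy, `zsigmondy_add`);
* `x, y` both even (then `z` is odd): one of the three primes is `2` by parity; `r = 2` is impossible
  mod `4`, so the triple is `4^u + q^(2v) = r^z` (or its mirror): `c` prime (`z = 1`, `c ≤ rad`) or the
  solved family L1 (`x² + 2^k = yⁿ`, `z ≥ 3`);
* `x, z` (or `y, z`) share an odd prime `ℓ`: `R^ℓ − A^ℓ = q^y`. If `R − A ≥ 2` then `R − A = q^t`,
  `t ≥ 1`, which Zsigmondy (`zsigmondy_sub`) forbids (`no_diff_shape`); so `R = A + 1` (consecutive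
  base): `y = 1` gives `c < R·q ≤ 2pqr ≤ 2·rad` by Mihăilescu's theorem on the consecutive prime
  powers `A, A + 1` (`succ_primePow_le`); `y ≥ 2` is the solved family L4 (`ℓ ≥ 5`, `2 ∣ y ∨ 3 ∣ y`,
  Darmon–Merel), the wall W3 (`3 ∤ y` and (`ℓ = 3` or `2 ∤ y`)), or — `ℓ = 3`, `3 ∣ y` — empty by
  Fermat's Last Theorem for exponent `3` (Mathlib `fermatLastTheoremThree`).

The conclusion lists exactly the disjuncts of the route statement that occur; the assembly places them.
-/

-- `Summit.<Summit>.<Problem>` is the mandated summit-side namespace (CONVENTIONS §2); for the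
-- single-conjunct summit `ABC` the two coincide, so the duplicate `ABC.ABC` is deliberate.
set_option linter.dupNamespace false

namespace Summit.ABC.ABC.Theorems.ThreeSlotThreePPRest

open Literature.NumberTheory.DiophantineGeometry (IsABCTriple rad rad_def rad_swap mihailescu_holds)
open UniqueFactorizationMonoid (radical)
open Literature.NumberTheory.Congruences.Zsigmondy (zsigmondy_add zsigmondy_sub)
open Summit.ABC.ABC.Theorems.ThreeSlotShapes (threePP_shape)
open Summit.ABC.ABC.Theorems.ThreeSlotZooSquareSquare (mul_dvd_radical)
open Summit.ABC.ABC.Theorems.UniformSadicTowerFour.ThreeSlotWall (two_dvd_abc)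

/-! ## The two empty shapes (Zsigmondy) -/

/-- **`A^ℓ + B^ℓ = r^z` is empty** for coprime `A, B ≥ 2`, `r` prime and `ℓ ≥ 3` odd: `A + B = r^s`
(`s ≥ 1`) divides `A^ℓ + B^ℓ`, so `r ∣ A + B`, contradicting the primitive prime divisor of
`A^ℓ + B^ℓ` (Bang–Zsigmondy; the exception `2³ + 1` has `B = 1`). [folklore; Zsigmondy 1892] -/
theorem no_sum_shape {A B r ℓ z : ℕ} (hr : r.Prime) (hA : 2 ≤ A) (hB : 2 ≤ B)
    (hAB : Nat.Coprime A B) (hℓ : 3 ≤ ℓ) (hℓo : Odd ℓ) (h : A ^ ℓ + B ^ ℓ = r ^ z) : False := by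
  have hne : A ≠ B := by
    rintro rfl
    have := hAB.eq_one_of_dvd dvd_rfl
    omega
  wlog hBA : B < A generalizing A B
  · exact this hB hA hAB.symm (by rwa [add_comm]) hne.symm (by omega)
  obtain ⟨Q, hQ, hQd, hprim⟩ :=
    zsigmondy_add (by omega : 1 ≤ B) hBA hAB (by omega : 2 ≤ ℓ) (fun ⟨_, hB1, _⟩ => by omega)
  rw [h] at hQd
  have hQr : Q = r := (Nat.prime_dvd_prime_iff_eq hQ hr).mp (hQ.dvd_of_dvd_pow hQd)
  have hdvd : A + B ∣ r ^ z := h ▸ Odd.nat_add_dvd_pow_add_pow A B hℓo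
  obtain ⟨s, -, hABs⟩ := (Nat.dvd_prime_pow hr).mp hdvd
  have hs1 : s ≠ 0 := by
    rintro rfl
    rw [pow_zero] at hABs
    omega
  have hrAB : r ∣ A + B := by rw [hABs]; exact dvd_pow_self r hs1
  exact hprim 1 one_pos (by omega) (by rw [pow_one, pow_one, hQr]; exact hrAB)

/-- **`R^ℓ − A^ℓ = q^y` with `q ∣ R − A` is empty** for coprime `R > A ≥ 2`, `q` prime, `ℓ ≥ 3`:
a primitive prime divisor of `R^ℓ − A^ℓ` (Zsigmondy; the exceptions need `ℓ = 2` or `A = 1`) is `q`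
and does not divide `R − A = q^t`. [folklore; Zsigmondy 1892] -/
theorem no_diff_shape {A R q ℓ y t : ℕ} (hq : q.Prime) (hA : 2 ≤ A) (hAR : A < R)
    (hcop : Nat.Coprime R A) (hℓ : 3 ≤ ℓ) (ht : 1 ≤ t) (hRA : A + q ^ t = R)
    (h : A ^ ℓ + q ^ y = R ^ ℓ) : False := by
  obtain ⟨Q, hQ, hQd, hprim⟩ := zsigmondy_sub (by omega : 1 ≤ A) hAR hcop (by omega : 2 ≤ ℓ)
    (fun h2 => absurd h2 (by omega)) (fun ⟨_, hA1, _⟩ => by omega)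
  have e1 : R ^ ℓ - A ^ ℓ = q ^ y := by omega
  rw [e1] at hQd
  have hQq : Q = q := (Nat.prime_dvd_prime_iff_eq hQ hq).mp (hQ.dvd_of_dvd_pow hQd)
  have e2 : R ^ 1 - A ^ 1 = q ^ t := by rw [pow_one, pow_one]; omega
  exact hprim 1 one_pos (by omega) (by rw [e2, hQq]; exact dvd_pow_self q (by omega))

/-! ## The consecutive base -/

/-- **Consecutive prime powers** `p^i + 1 = r^k` (`p, r` prime, `i, k ≥ 1`): `k = 1`, or `i = 1`, or
`(p^i, r^k) = (8, 9)` by Mihăilescu's theorem (`mihailescu_holds`); in every case `r^k ≤ 2·p·r`.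
[folklore; Catalan–Mihăilescu] -/
theorem succ_primePow_le {p r i k : ℕ} (hp : p.Prime) (hr : r.Prime) (hi : 1 ≤ i) (hk : 1 ≤ k)
    (h : p ^ i + 1 = r ^ k) : r ^ k ≤ 2 * p * r := by
  have hp2 := hp.two_le
  have hr2 := hr.two_le
  rcases Nat.lt_or_ge k 2 with hk1 | hk2
  · have hk1' : k = 1 := by omega
    subst hk1'
    rw [pow_one]
    nlinarith
  rcases Nat.lt_or_ge i 2 with hi1 | hi2
  · have hi1' : i = 1 := by omega
    subst hi1'
    rw [pow_one] at h
    rw [← h]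
    nlinarith
  · obtain ⟨rfl, rfl, rfl, rfl⟩ :=
      mihailescu_holds (x := r) (y := p) (a := k) (b := i) hp.pos hk2 hi2 h.symm
    norm_num

/-- For `A ≥ 1`, `ℓ ≥ 2` and `A^ℓ + b = (A+1)^ℓ`: `(A+1)^ℓ < (A+1)·b` (since `b > (A+1)^(ℓ-1)`).
[folklore] -/
theorem pow_lt_mul_of_consecutive {A b ℓ : ℕ} (hA : 1 ≤ A) (hℓ : 2 ≤ ℓ)
    (h : A ^ ℓ + b = (A + 1) ^ ℓ) : (A + 1) ^ ℓ < (A + 1) * b := by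
  obtain ⟨m, rfl⟩ : ∃ m, ℓ = m + 2 := ⟨ℓ - 2, by omega⟩
  have h1 : A ^ (m + 1) < (A + 1) ^ (m + 1) := Nat.pow_lt_pow_left (by omega) (by omega)
  have h2 : A * A ^ (m + 1) < A * (A + 1) ^ (m + 1) := Nat.mul_lt_mul_of_pos_left h1 (by omega)
  have e1 : (A + 1) ^ (m + 2) = A * (A + 1) ^ (m + 1) + (A + 1) ^ (m + 1) := by ring
  have e2 : A ^ (m + 2) = A * A ^ (m + 1) := by ring
  have hb : (A + 1) ^ (m + 1) < b := by
    rw [e1, e2] at h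
    omega
  calc (A + 1) ^ (m + 2) = (A + 1) * (A + 1) ^ (m + 1) := by ring
    _ < (A + 1) * b := Nat.mul_lt_mul_of_pos_left hb (by omega)

/-- `p·q·r ≤ rad(p^x q^y r^z)` for three distinct primes and `x, y, z ≥ 1`. [folklore] -/
theorem pqr_le_rad {p q r x y z : ℕ} (hp : p.Prime) (hq : q.Prime) (hr : r.Prime) (hpq : p ≠ q)
    (hpr : p ≠ r) (hqr : q ≠ r) (hx : 1 ≤ x) (hy : 1 ≤ y) (hz : 1 ≤ z) :
    p * q * r ≤ rad (p ^ x) (q ^ y) (r ^ z) := by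
  have hp0 := hp.pos
  have hq0 := hq.pos
  have hr0 := hr.pos
  have hn : p ^ x * q ^ y * r ^ z ≠ 0 := by positivity
  rw [rad_def]
  refine Nat.le_of_dvd (Nat.radical_pos _) (mul_dvd_radical hp hq hr hpq hpr hqr hn ?_ ?_ ?_)
  · exact Dvd.dvd.mul_right (Dvd.dvd.mul_right (dvd_pow_self p (by omega)) _) _
  · exact Dvd.dvd.mul_right (Dvd.dvd.mul_left (dvd_pow_self q (by omega)) _) _
  · exact Dvd.dvd.mul_left (dvd_pow_self r (by omega)) _

/-- The square of an odd number is `1 (mod 4)`, in the form `p^(2u) % 4 = 1`. [folklore] -/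
theorem pow_two_mul_mod_four {p u : ℕ} (hp : Odd p) : p ^ (2 * u) % 4 = 1 := by
  rw [pow_mul']
  have ho : (p ^ u) % 2 = 1 := Nat.odd_iff.mp hp.pow
  have h4 : p ^ u % 4 = 1 ∨ p ^ u % 4 = 3 := by omega
  rw [Nat.pow_mod]
  rcases h4 with h4 | h4 <;> rw [h4]

/-! ## One orientation: the exponents of `a` and `c` share an odd prime -/

/-- **Core (one orientation).** `p^x + q^y = r^z` with an odd prime `ℓ ∣ x`, `ℓ ∣ z`: `c ≤ 5·rad`, or
the solved family L4, or the wall W3 (see the module docstring). [folklore] -/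
theorem core_xz {p q r x y z ℓ : ℕ} (hp : p.Prime) (hq : q.Prime) (hr : r.Prime) (hpq : p ≠ q)
    (hpr : p ≠ r) (hqr : q ≠ r) (hx : 1 ≤ x) (hy : 1 ≤ y) (hz : 1 ≤ z)
    (h : p ^ x + q ^ y = r ^ z) (hℓ : ℓ.Prime) (hℓ2 : ℓ ≠ 2) (hℓx : ℓ ∣ x) (hℓz : ℓ ∣ z) :
    r ^ z ≤ 5 * rad (p ^ x) (q ^ y) (r ^ z) ∨
    (∃ A l Q Y : ℕ, Q.Prime ∧ 5 ≤ l ∧ 2 ≤ Y ∧ (2 ∣ Y ∨ 3 ∣ Y) ∧ p ^ x = A ^ l ∧ q ^ y = Q ^ Y ∧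
      r ^ z = (A + 1) ^ l) ∨
    (∃ A l Q Y : ℕ, Q.Prime ∧ 3 ≤ l ∧ 2 ≤ Y ∧ ¬ 3 ∣ Y ∧ (l = 3 ∨ ¬ 2 ∣ Y) ∧ p ^ x = A ^ l ∧
      q ^ y = Q ^ Y ∧ r ^ z = (A + 1) ^ l) := by
  obtain ⟨i, hi⟩ := hℓx
  obtain ⟨k, hk⟩ := hℓz
  have hℓ3 : 3 ≤ ℓ := by have := hℓ.two_le; omega
  have hi1 : i ≠ 0 := by rintro rfl; simp at hi; omega
  have hk1 : k ≠ 0 := by rintro rfl; simp at hk; omega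
  have hxA : p ^ x = (p ^ i) ^ ℓ := by rw [hi, mul_comm, pow_mul]
  have hzR : r ^ z = (r ^ k) ^ ℓ := by rw [hk, mul_comm, pow_mul]
  set A := p ^ i with hA
  set R := r ^ k with hR
  clear_value A R
  have h' : A ^ ℓ + q ^ y = R ^ ℓ := by rw [← hxA, ← hzR]; exact h
  have hA2 : 2 ≤ A := hA ▸ le_trans hp.two_le (Nat.le_self_pow hi1 p)
  have hAR : A < R := by
    have hq1 : 1 ≤ q ^ y := Nat.one_le_pow y q hq.pos
    have : A ^ ℓ < R ^ ℓ := by omega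
    exact (Nat.pow_lt_pow_iff_left (by omega)).mp this
  have hrad : p * q * r ≤ rad (p ^ x) (q ^ y) (r ^ z) := pqr_le_rad hp hq hr hpq hpr hqr hx hy hz
  by_cases hcons : R = A + 1
  · -- consecutive base `R = A + 1`
    rcases Nat.lt_or_ge y 2 with hy1 | hy2
    · -- `y = 1`: `c < R q ≤ 2 p q r ≤ 2 rad`
      left
      have hy1' : y = 1 := by omega
      subst hy1'
      rw [pow_one] at h'
      have hRle : R ≤ 2 * p * r := by
        rw [hR]
        exact succ_primePow_le hp hr (Nat.pos_of_ne_zero hi1) (Nat.pos_of_ne_zero hk1)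
          (by rw [← hA, ← hR]; omega)
      have hlt : R ^ ℓ < R * q := by
        rw [hcons] at h' ⊢
        exact pow_lt_mul_of_consecutive (by omega) (by omega) h'
      calc r ^ z = R ^ ℓ := hzR
        _ ≤ R * q := hlt.le
        _ ≤ 2 * p * r * q := Nat.mul_le_mul_right q hRle
        _ = 2 * (p * q * r) := by ring
        _ ≤ 2 * rad (p ^ x) (q ^ 1) (r ^ z) := Nat.mul_le_mul_left 2 hrad
        _ ≤ 5 * rad (p ^ x) (q ^ 1) (r ^ z) := by omega
    · -- `y ≥ 2`
      rcases Nat.lt_or_ge ℓ 5 with hℓ5 | hℓ5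
      · -- `ℓ = 3` (`ℓ = 4` is not prime)
        have hℓ3' : ℓ = 3 := by
          interval_cases ℓ
          · rfl
          · exact absurd hℓ (by decide)
        subst hℓ3'
        by_cases h3y : 3 ∣ y
        · -- `(3, 3, 3j)`: Fermat's Last Theorem for exponent 3
          exfalso
          obtain ⟨j, hj⟩ := h3y
          have hflt : A ^ 3 + (q ^ j) ^ 3 = R ^ 3 := by rw [← pow_mul, mul_comm, ← hj]; exact h'
          exact fermatLastTheoremThree A (q ^ j) R (by omega) (pow_ne_zero _ hq.ne_zero) (by omega)
            hflt
        · right; right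
          exact ⟨A, 3, q, y, hq, le_rfl, hy2, h3y, Or.inl rfl, hxA, rfl, by rw [hzR, hcons]⟩
      · by_cases h23 : 2 ∣ y ∨ 3 ∣ y
        · right; left
          exact ⟨A, ℓ, q, y, hq, hℓ5, hy2, h23, hxA, rfl, by rw [hzR, hcons]⟩
        · right; right
          push Not at h23
          exact ⟨A, ℓ, q, y, hq, hℓ3, hy2, h23.2, Or.inr h23.1, hxA, rfl, by rw [hzR, hcons]⟩
  · -- `R ≥ A + 2`: then `R - A = q^t` with `t ≥ 1`, impossible
    exfalso
    have hd : R - A ∣ q ^ y := by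
      have e : R ^ ℓ - A ^ ℓ = q ^ y := by omega
      have := Nat.sub_dvd_pow_sub_pow R A ℓ
      rwa [e] at this
    obtain ⟨t, -, ht⟩ := (Nat.dvd_prime_pow hq).mp hd
    have ht1 : 1 ≤ t := by
      by_contra ht0
      have ht0' : t = 0 := by omega
      rw [ht0', pow_zero] at ht
      omega
    have hcop : Nat.Coprime R A := by
      rw [hA, hR]
      exact Nat.Coprime.pow k i ((Nat.coprime_primes hr hp).mpr hpr.symm)
    exact no_diff_shape hq hA2 hAR hcop hℓ3 ht1 (by omega) h'

/-! ## The stub -/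

/-- **Three prime powers with a shared exponent factor** (birth stub `stub_threePP_rest` of
`ZooSorting`): an abc triple with `ω(abc) ≤ 3`, `a, b ≥ 2`, exponents NOT pairwise coprime and no even
pair through the exponent of `c`, has `c ≤ 5 · rad`, or lies in L1, L4, W3 (either orientation).
[folklore] -/
theorem threePP_rest : ∀ a b c : ℕ, IsABCTriple a b c → (a * b * c).primeFactors.card ≤ 3 →
    2 ≤ a → 2 ≤ b →
    ¬ (Nat.Coprime (Nat.log a.minFac a) (Nat.log b.minFac b) ∧
      Nat.Coprime (Nat.log a.minFac a) (Nat.log c.minFac c) ∧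
      Nat.Coprime (Nat.log b.minFac b) (Nat.log c.minFac c)) →
    ¬ (2 ∣ Nat.log c.minFac c ∧ (2 ∣ Nat.log a.minFac a ∨ 2 ∣ Nat.log b.minFac b)) →
    c ≤ 5 * rad a b c ∨
    (∃ u v q r z : ℕ, q.Prime ∧ r.Prime ∧ 1 ≤ u ∧ 1 ≤ v ∧ 3 ≤ z ∧ a = 2 ^ (2 * u) ∧
      b = q ^ (2 * v) ∧ c = r ^ z) ∨
    (∃ u v q r z : ℕ, q.Prime ∧ r.Prime ∧ 1 ≤ u ∧ 1 ≤ v ∧ 3 ≤ z ∧ b = 2 ^ (2 * u) ∧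
      a = q ^ (2 * v) ∧ c = r ^ z) ∨
    (∃ A l q y : ℕ, q.Prime ∧ 5 ≤ l ∧ 2 ≤ y ∧ (2 ∣ y ∨ 3 ∣ y) ∧ a = A ^ l ∧ b = q ^ y ∧
      c = (A + 1) ^ l) ∨
    (∃ A l q y : ℕ, q.Prime ∧ 5 ≤ l ∧ 2 ≤ y ∧ (2 ∣ y ∨ 3 ∣ y) ∧ b = A ^ l ∧ a = q ^ y ∧
      c = (A + 1) ^ l) ∨
    (∃ A l q y : ℕ, q.Prime ∧ 3 ≤ l ∧ 2 ≤ y ∧ ¬ 3 ∣ y ∧ (l = 3 ∨ ¬ 2 ∣ y) ∧ a = A ^ l ∧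
      b = q ^ y ∧ c = (A + 1) ^ l) ∨
    (∃ A l q y : ℕ, q.Prime ∧ 3 ≤ l ∧ 2 ≤ y ∧ ¬ 3 ∣ y ∧ (l = 3 ∨ ¬ 2 ∣ y) ∧ b = A ^ l ∧
      a = q ^ y ∧ c = (A + 1) ^ l) := by
  intro a b c ht hω ha hb hncop hnev
  obtain ⟨hpa, hpb, hpc, hab, hac, hbc, hxa, hxb, hxc, hea, heb, hec⟩ := threePP_shape ht hω ha hb
  generalize a.minFac = p at *
  generalize b.minFac = q at *
  generalize c.minFac = r at *
  generalize Nat.log p a = x at *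
  generalize Nat.log q b = y at *
  generalize Nat.log r c = z at *
  subst hea heb hec
  have h : p ^ x + q ^ y = r ^ z := ht.2.2.1
  have hrad : p * q * r ≤ rad (p ^ x) (q ^ y) (r ^ z) := pqr_le_rad hpa hpb hpc hab hac hbc hxa hxb hxc
  by_cases hxy : Nat.Coprime x y
  · by_cases hxz : Nat.Coprime x z
    · -- `y, z` share a prime: mirror of the core
      have hyz : ¬ Nat.Coprime y z := fun hyz => hncop ⟨hxy, hxz, hyz⟩
      obtain ⟨ℓ, hℓ, hℓy, hℓz⟩ := Nat.Prime.not_coprime_iff_dvd.mp hyz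
      have hℓ2 : ℓ ≠ 2 := by rintro rfl; exact hnev ⟨hℓz, Or.inr hℓy⟩
      have h' : q ^ y + p ^ x = r ^ z := by omega
      rcases core_xz hpb hpa hpc hab.symm hbc hac hxb hxa hxc h' hℓ hℓ2 hℓy hℓz with
          hle | ⟨A, l, Q, Y, hQ, hl, hY, h23, hbA, haQ, hcR⟩ | ⟨A, l, Q, Y, hQ, hl, hY, h3, h2, hbA, haQ, hcR⟩
      · left; rwa [rad_swap] at hle
      · right; right; right; right; left
        exact ⟨A, l, Q, Y, hQ, hl, hY, h23, hbA, haQ, hcR⟩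
      · right; right; right; right; right; right
        exact ⟨A, l, Q, Y, hQ, hl, hY, h3, h2, hbA, haQ, hcR⟩
    · -- `x, z` share a prime: the core
      obtain ⟨ℓ, hℓ, hℓx, hℓz⟩ := Nat.Prime.not_coprime_iff_dvd.mp hxz
      have hℓ2 : ℓ ≠ 2 := by rintro rfl; exact hnev ⟨hℓz, Or.inl hℓx⟩
      rcases core_xz hpa hpb hpc hab hac hbc hxa hxb hxc h hℓ hℓ2 hℓx hℓz with
          hle | ⟨A, l, Q, Y, hQ, hl, hY, h23, haA, hbQ, hcR⟩ | ⟨A, l, Q, Y, hQ, hl, hY, h3, h2, haA, hbQ, hcR⟩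
      · left; exact hle
      · right; right; right; left
        exact ⟨A, l, Q, Y, hQ, hl, hY, h23, haA, hbQ, hcR⟩
      · right; right; right; right; right; left
        exact ⟨A, l, Q, Y, hQ, hl, hY, h3, h2, haA, hbQ, hcR⟩
  · -- `x, y` share a prime `ℓ`
    obtain ⟨ℓ, hℓ, hℓx, hℓy⟩ := Nat.Prime.not_coprime_iff_dvd.mp hxy
    by_cases hℓ2 : ℓ = 2
    · -- `x, y` even, hence `z` odd; one of the primes is `2`
      subst hℓ2
      have hz2 : ¬ 2 ∣ z := fun hz2 => hnev ⟨hz2, Or.inl hℓx⟩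
      obtain ⟨u, hu⟩ := hℓx
      obtain ⟨v, hv⟩ := hℓy
      have hu1 : 1 ≤ u := by omega
      have hv1 : 1 ≤ v := by omega
      rcases two_dvd_abc ht with h2 | h2 | h2
      · -- `p = 2`: L1, or `c` prime
        have hp2 : p = 2 :=
          ((Nat.prime_dvd_prime_iff_eq Nat.prime_two hpa).mp (Nat.prime_two.dvd_of_dvd_pow h2)).symm
        rcases Nat.lt_or_ge z 3 with hz3 | hz3
        · left
          have hz1 : z = 1 := by omega
          subst hz1
          have : r ≤ p * q * r := Nat.le_mul_of_pos_left r (Nat.mul_pos hpa.pos hpb.pos)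
          rw [pow_one] at hrad ⊢
          omega
        · right; left
          exact ⟨u, v, q, r, z, hpb, hpc, hu1, hv1, hz3, by rw [hp2, hu], by rw [hv], rfl⟩
      · -- `q = 2`: L1 mirrored, or `c` prime
        have hq2 : q = 2 :=
          ((Nat.prime_dvd_prime_iff_eq Nat.prime_two hpb).mp (Nat.prime_two.dvd_of_dvd_pow h2)).symm
        rcases Nat.lt_or_ge z 3 with hz3 | hz3
        · left
          have hz1 : z = 1 := by omega
          subst hz1
          have : r ≤ p * q * r := Nat.le_mul_of_pos_left r (Nat.mul_pos hpa.pos hpb.pos)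
          rw [pow_one] at hrad ⊢
          omega
        · right; right; left
          exact ⟨v, u, p, r, z, hpa, hpc, hv1, hu1, hz3, by rw [hq2, hv], by rw [hu], rfl⟩
      · -- `r = 2`: impossible mod `4`
        exfalso
        have hr2 : r = 2 :=
          ((Nat.prime_dvd_prime_iff_eq Nat.prime_two hpc).mp (Nat.prime_two.dvd_of_dvd_pow h2)).symm
        subst hr2
        have hpo : Odd p := hpa.odd_of_ne_two hac
        have hqo : Odd q := hpb.odd_of_ne_two hbc
        have h4p : p ^ x % 4 = 1 := by rw [hu]; exact pow_two_mul_mod_four hpo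
        have h4q : q ^ y % 4 = 1 := by rw [hv]; exact pow_two_mul_mod_four hqo
        have hpx : 2 ≤ p ^ x := le_trans hpa.two_le (Nat.le_self_pow (by omega) p)
        have hqy : 2 ≤ q ^ y := le_trans hpb.two_le (Nat.le_self_pow (by omega) q)
        rcases Nat.lt_or_ge z 2 with hz1 | hz2'
        · have hz1' : z = 1 := by omega
          subst hz1'
          omega
        · obtain ⟨w, rfl⟩ := Nat.exists_eq_add_of_le hz2'
          have : 2 ^ (2 + w) % 4 = 0 := by rw [pow_add]; simp
          omega
    · -- `x, y` share an odd prime: `A^ℓ + B^ℓ = r^z` is empty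
      exfalso
      obtain ⟨i, hi⟩ := hℓx
      obtain ⟨j, hj⟩ := hℓy
      have hi1 : i ≠ 0 := by rintro rfl; simp at hi; omega
      have hj1 : j ≠ 0 := by rintro rfl; simp at hj; omega
      have hℓ3 : 3 ≤ ℓ := by have := hℓ.two_le; omega
      have h' : (p ^ i) ^ ℓ + (q ^ j) ^ ℓ = r ^ z := by
        rw [← pow_mul, ← pow_mul, mul_comm i, mul_comm j, ← hi, ← hj]; exact h
      exact no_sum_shape hpc (le_trans hpa.two_le (Nat.le_self_pow hi1 p))
        (le_trans hpb.two_le (Nat.le_self_pow hj1 q))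
        (Nat.Coprime.pow i j ((Nat.coprime_primes hpa hpb).mpr hab)) hℓ3 (hℓ.odd_of_ne_two hℓ2) h'

end Summit.ABC.ABC.Theorems.ThreeSlotThreePPRest
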